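import Mathlib
import HarnessLib
import Summits.ResolutionOfSingularities.ResolutionOfSingularities.Theorems.WildQuotientsWildQuotientResolutionS1aKillExo

/-!
# S1a — formal K-TIGHT, ring half: the reduced fixed ideal sits inside the centre; `aug` is principal off `V(f)` and non-principal over `V(J̃)`

[OURS · L1 W4.5c · lead-1 g11; plan-1 K-LOC v1.1 §4b «K-TIGHT», ASSIGNMENT v10.31 (K3 formal): «state the ring half: aug_u not principal at every
prime over V(f), principal off V(f)»] — NOT statements of the manuscript; counted 0; AI-level work, weaker than expert review. Crux
stmt-ResolutionOfSingularities-17941 `CyclicQuotientFourfolds`, line `s1a-logminvertex` v11, K-side. Route-independent; SEMANTICS-AGNOSTIC pure algebra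
(no badness notion enters; F10/R-F10: which points are «bad» in the game is a separate question).

SETTING. `σ` an automorphism of `B`, `β ∈ B` a non-zero-divisor with the boundary-admissibility (a′)_δ for a weighted centre `(f, w)`
(`y ∈ 𝒥ₙ ⇒ σ y − y ∈ β 𝒥ₙ₊δ`); `J̃ := (aug σ : β)` the REDUCED FIXED IDEAL.
* `augmentationIdeal_le_span_of_admissible` — (FD1) `aug σ ≤ (β)`; `augmentationIdeal_eq_span_mul_colon` — `aug σ = (β) · J̃`;
* ★ `colon_le_weightedFiltration_of_admissible` — `J̃ ≤ 𝒥_δ`; `weightedFiltration_le_span` — `𝒥ₙ ≤ (f)` for `n ≥ 1`; hence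
  ★ `colon_le_span_of_admissible` — **`J̃ ≤ (f)` when `δ ≥ 1`**: the reduced fixed locus CONTAINS the centre `V(f)` … i.e. `V(J̃) ⊇`—no: `V(f) ⊆ V(J̃)`,
  every point of the kill centre is a zero of the reduced fixed ideal («θ̃(B) ⊆ (f)», K-LOC v1.1 §4b STEP J̃ ⊆ (f));
* ★ `map_augmentationIdeal_away_eq_span` — **principal OFF `V(f)`**: if `β b^k ∈ aug σ` ((FD2) at `b`, e.g. `b ∈ (f)` when `V(J̃) ⊆ V(f)`), then
  `aug σ · B[b⁻¹] = (β)`;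
* ★★ `not_isPrincipal_map_augmentationIdeal_atPrime` — **non-principal OVER `V(J̃)`** (B a Noetherian domain): if `J̃` lies in no prime of height `≤ 1`
  («`β` is the FULL fixed divisor»: `ht J̃ ≥ 2`) then at every prime `𝔭 ⊇ J̃` the localised augmentation ideal `aug σ · B_𝔭` is NOT principal
  (else `J̃ B_𝔭` is a proper principal ideal and Krull's Hauptidealsatz `Ideal.height_le_one_of_isPrincipal_of_mem_minimalPrimes` gives a prime of
  height `≤ 1` over `J̃`). With `J̃ ≤ (f)`: non-principal at every prime over `V(f)`.
-/

set_option linter.dupNamespace false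

noncomputable section

open Literature.AlgebraicGeometry.Resolution
open Summit.ResolutionOfSingularities.ResolutionOfSingularities.Theorems.WildQuotientResolution.S1.CoarseChart

namespace Summit.ResolutionOfSingularities.ResolutionOfSingularities.Theorems.WildQuotientResolution.S1.KillCert

universe u

variable {B : Type u} [CommRing B] {c : ℕ} (f : Fin c → B) (w : Fin c → ℕ) (σ : B ≃+* B) (β : B) (δ : ℕ)

/-! ## (FD1) and `J̃ ≤ 𝒥_δ ≤ (f)` from (a′)_δ -/

/-- (a′)_δ ⇒ **(FD1)** `aug σ ≤ β · 𝒥_δ ≤ (β)`. [OURS · L1 W4.5c] -/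
theorem augmentationIdeal_le_span_mul_of_admissible
    (hadm : ∀ (n : ℕ) (y : B), y ∈ (weightedFiltration f w).ideal n →
      σ y - y ∈ Ideal.span {β} * (weightedFiltration f w).ideal (n + δ)) :
    augmentationIdeal σ ≤ Ideal.span {β} * (weightedFiltration f w).ideal δ := by
  rw [augmentationIdeal, Ideal.span_le]
  rintro _ ⟨y, rfl⟩
  have := hadm 0 y (mem_weightedFiltration_zero f w y)
  rwa [zero_add] at this

/-- (a′)_δ ⇒ (FD1) `aug σ ≤ (β)`. [OURS · L1 W4.5c] -/
theorem augmentationIdeal_le_span_of_admissible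
    (hadm : ∀ (n : ℕ) (y : B), y ∈ (weightedFiltration f w).ideal n →
      σ y - y ∈ Ideal.span {β} * (weightedFiltration f w).ideal (n + δ)) :
    augmentationIdeal σ ≤ Ideal.span {β} :=
  (augmentationIdeal_le_span_mul_of_admissible f w σ β δ hadm).trans Ideal.mul_le_right

/-- **`aug σ = (β) · J̃`** with `J̃ = (aug σ : β)`, under (FD1). [OURS · L1 W4.5c] -/
theorem augmentationIdeal_eq_span_mul_colon (hFD1 : augmentationIdeal σ ≤ Ideal.span {β}) :
    augmentationIdeal σ = Ideal.span {β} * (augmentationIdeal σ).colon (Ideal.span {β}) := by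
  apply le_antisymm
  · intro x hx
    obtain ⟨j, rfl⟩ := Ideal.mem_span_singleton'.mp (hFD1 hx)
    rw [show j * β = β * j from mul_comm _ _]
    exact Ideal.mul_mem_mul (Ideal.mem_span_singleton_self β) (Ideal.mem_colon_span_singleton.mpr hx)
  · rw [Ideal.mul_le]
    intro a ha j hj
    obtain ⟨r, rfl⟩ := Ideal.mem_span_singleton'.mp ha
    rw [mul_assoc, mul_comm β j]
    exact Ideal.mul_mem_left _ _ (Ideal.mem_colon_span_singleton.mp hj)

/-- ★ (a′)_δ ⇒ **`J̃ ≤ 𝒥_δ`** (`β` a non-zero-divisor): the reduced increments raise the order by `δ` already from order `0`. [OURS · L1 W4.5c · K-LOC v1.1 §4b] -/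
theorem colon_le_weightedFiltration_of_admissible (hβ : β ∈ nonZeroDivisors B)
    (hadm : ∀ (n : ℕ) (y : B), y ∈ (weightedFiltration f w).ideal n →
      σ y - y ∈ Ideal.span {β} * (weightedFiltration f w).ideal (n + δ)) :
    (augmentationIdeal σ).colon (Ideal.span {β}) ≤ (weightedFiltration f w).ideal δ := by
  intro x hx
  have hβx : β * x ∈ Ideal.span {β} * (weightedFiltration f w).ideal δ :=
    augmentationIdeal_le_span_mul_of_admissible f w σ β δ hadm (by rw [mul_comm]; exact Ideal.mem_colon_span_singleton.mp hx)
  obtain ⟨t, ht, hxt⟩ := Ideal.mem_span_singleton_mul.mp hβx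
  have : x = t := (mul_cancel_left_mem_nonZeroDivisors hβ).mp hxt.symm
  rwa [this]

/-- `𝒥ₙ ≤ (f)` for `n ≥ 1` (a monomial of positive weight has a factor `fᵢ`). [folklore] -/
theorem weightedFiltration_le_span {n : ℕ} (hn : 1 ≤ n) : (weightedFiltration f w).ideal n ≤ Ideal.span (Set.range f) := by
  rw [weightedFiltration_ideal, Ideal.span_le]
  rintro _ ⟨α, hα, rfl⟩
  have hα0 : α ≠ 0 := by
    rintro rfl
    rw [map_zero] at hα
    omega
  obtain ⟨i, hi⟩ := Finsupp.ne_iff.mp hα0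
  rw [Finsupp.coe_zero, Pi.zero_apply] at hi
  have hdvd : f i ∣ α.prod fun i e => f i ^ e :=
    (dvd_pow_self _ hi).trans (Finset.dvd_prod_of_mem (fun j => f j ^ α j) (Finsupp.mem_support_iff.mpr hi))
  obtain ⟨r, hr⟩ := hdvd
  rw [SetLike.mem_coe, hr]
  exact Ideal.mul_mem_right _ _ (Ideal.subset_span ⟨i, rfl⟩)

/-- ★ (a′)_δ with `δ ≥ 1` ⇒ **`J̃ ≤ (f)`**: every point of the centre `V(f)` is a zero of the reduced fixed ideal. [OURS · L1 W4.5c · K-LOC v1.1 §4b] -/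
theorem colon_le_span_of_admissible (hβ : β ∈ nonZeroDivisors B) (hδ : 1 ≤ δ)
    (hadm : ∀ (n : ℕ) (y : B), y ∈ (weightedFiltration f w).ideal n →
      σ y - y ∈ Ideal.span {β} * (weightedFiltration f w).ideal (n + δ)) :
    (augmentationIdeal σ).colon (Ideal.span {β}) ≤ Ideal.span (Set.range f) :=
  (colon_le_weightedFiltration_of_admissible f w σ β δ hβ hadm).trans (weightedFiltration_le_span f w hδ)

/-! ## Principal off `V(f)` -/

/-- ★ **`aug σ` is principal off the reduced fixed locus**: (FD1) and `β b^k ∈ aug σ` give `aug σ · B[b⁻¹] = (β)`. [OURS · L1 W4.5c] -/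
theorem map_augmentationIdeal_away_eq_span {S : Type*} [CommRing S] [Algebra B S] (b : B) [IsLocalization.Away b S]
    (hFD1 : augmentationIdeal σ ≤ Ideal.span {β}) {k : ℕ} (hk : β * b ^ k ∈ augmentationIdeal σ) :
    (augmentationIdeal σ).map (algebraMap B S) = Ideal.span {algebraMap B S β} := by
  apply le_antisymm
  · refine (Ideal.map_mono hFD1).trans ?_
    rw [Ideal.map_span, Set.image_singleton]
  · rw [Ideal.span_singleton_le_iff_mem]
    have h1 : algebraMap B S (β * b ^ k) ∈ (augmentationIdeal σ).map (algebraMap B S) := Ideal.mem_map_of_mem _ hk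
    rw [map_mul, map_pow] at h1
    exact (Ideal.mul_unit_mem_iff_mem _ ((IsLocalization.Away.algebraMap_isUnit b).pow k)).mp h1

/-- (FD2) from `J̃`: if `b^k ∈ J̃` then `β b^k ∈ aug σ`. [folklore] -/
theorem mul_pow_mem_augmentationIdeal_of_pow_mem_colon {b : B} {k : ℕ}
    (hb : b ^ k ∈ (augmentationIdeal σ).colon (Ideal.span {β})) : β * b ^ k ∈ augmentationIdeal σ := by
  rw [mul_comm]; exact Ideal.mem_colon_span_singleton.mp hb

/-! ## Non-principal over `V(J̃)` when `β` is the full fixed divisor -/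

/-- In a domain: if `(β)·J = (π)` with `β ≠ 0` then `J` is principal. [folklore] -/
theorem exists_eq_span_of_span_mul_eq_span {D : Type*} [CommRing D] [IsDomain D] {b π : D} (hb : b ≠ 0) {J : Ideal D}
    (h : Ideal.span {b} * J = Ideal.span {π}) : ∃ j₀ : D, J = Ideal.span {j₀} := by
  have hπ : π ∈ Ideal.span {b} * J := h ▸ Ideal.mem_span_singleton_self π
  obtain ⟨j₀, hj₀, hπj⟩ := Ideal.mem_span_singleton_mul.mp hπ
  refine ⟨j₀, le_antisymm ?_ ((Ideal.span_singleton_le_iff_mem _).mpr hj₀)⟩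
  intro j hj
  have hbj : b * j ∈ Ideal.span {π} := h ▸ Ideal.mul_mem_mul (Ideal.mem_span_singleton_self b) hj
  obtain ⟨r, hr⟩ := Ideal.mem_span_singleton'.mp hbj
  rw [← hπj, ← mul_assoc, mul_comm r b, mul_assoc] at hr
  have : j = r * j₀ := (mul_left_cancel₀ hb hr).symm
  rw [this]
  exact Ideal.mul_mem_left _ _ (Ideal.mem_span_singleton_self j₀)

/-- ★★ **Over `V(J̃)` the augmentation ideal is NOT principal** when `β` is the FULL fixed divisor: `B` a Noetherian domain, `aug σ = (β)·J̃` with `J̃`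
contained in no prime of height `≤ 1`; then for every prime `𝔭 ⊇ J̃` the localisation `aug σ · B_𝔭` is not a principal ideal.
(Krull's Hauptidealsatz.) [OURS · L1 W4.5c · K-LOC v1.1 §4b STEP bad, ring half] -/
theorem not_isPrincipal_map_augmentationIdeal_atPrime [IsNoetherianRing B] [IsDomain B] (hβ : β ≠ 0)
    (hFD1 : augmentationIdeal σ ≤ Ideal.span {β})
    (hht : ∀ 𝔮 : Ideal B, 𝔮.IsPrime → (augmentationIdeal σ).colon (Ideal.span {β}) ≤ 𝔮 → 1 < 𝔮.height)
    (𝔭 : Ideal B) [𝔭.IsPrime] (h𝔭 : (augmentationIdeal σ).colon (Ideal.span {β}) ≤ 𝔭) :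
    ¬ ((augmentationIdeal σ).map (algebraMap B (Localization.AtPrime 𝔭))).IsPrincipal := by
  intro hprin
  set S := Localization.AtPrime 𝔭
  set J : Ideal B := (augmentationIdeal σ).colon (Ideal.span {β}) with hJ
  have haug : augmentationIdeal σ = Ideal.span {β} * J := augmentationIdeal_eq_span_mul_colon σ β hFD1
  -- `(β)·(J S) = (π)` in the domain `S`
  obtain ⟨⟨π, hπ⟩⟩ := hprin
  have hπ' : Ideal.span {algebraMap B S β} * J.map (algebraMap B S) = Ideal.span {π} := by
    rw [← Set.image_singleton, ← Ideal.map_span, ← Ideal.map_mul, ← haug, hπ]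
  have hβS : algebraMap B S β ≠ 0 := by
    intro h0
    exact hβ ((IsLocalization.injective S 𝔭.primeCompl_le_nonZeroDivisors).eq_iff.mp (h0.trans (map_zero _).symm))
  obtain ⟨j₀, hj₀⟩ := exists_eq_span_of_span_mul_eq_span hβS hπ'
  -- `J S` is proper: `J ≤ 𝔭`
  have hJS : J.map (algebraMap B S) ≠ ⊤ := by
    intro htop
    have hle : J.map (algebraMap B S) ≤ IsLocalRing.maximalIdeal S := by
      rw [← Localization.AtPrime.map_eq_maximalIdeal]
      exact Ideal.map_mono h𝔭
    exact (IsLocalRing.maximalIdeal.isMaximal S).ne_top (top_le_iff.mp (htop ▸ hle))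
  -- a minimal prime over the principal `J S` has height ≤ 1
  haveI : (J.map (algebraMap B S)).IsPrincipal := ⟨⟨j₀, by rw [hj₀]⟩⟩
  obtain ⟨𝔪, h𝔪max, hJ𝔪⟩ := Ideal.exists_le_maximal _ hJS
  haveI := h𝔪max.isPrime
  obtain ⟨𝔮', h𝔮'min, -⟩ := Ideal.exists_minimalPrimes_le hJ𝔪
  have hq'ht : 𝔮'.height ≤ 1 := Ideal.height_le_one_of_isPrincipal_of_mem_minimalPrimes _ 𝔮' h𝔮'min
  haveI := h𝔮'min.1.1
  -- pull back to `B`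
  have hunder : (𝔮'.under B).height = 𝔮'.height := IsLocalization.height_under 𝔭.primeCompl 𝔮'
  have hJq : J ≤ 𝔮'.under B := by
    rw [Ideal.under_def]
    exact (Ideal.le_comap_map).trans (Ideal.comap_mono h𝔮'min.1.2)
  have := hht (𝔮'.under B) inferInstance hJq
  rw [hunder] at this
  exact absurd hq'ht (not_le.mpr this)

end Summit.ResolutionOfSingularities.ResolutionOfSingularities.Theorems.WildQuotientResolution.S1.KillCert

end
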